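import Summits.QuantumFields.YangMills.Theorems.UnitScaleTiltProp7QTwFlatExplicitT3
import HarnessLib

/-!
# Route `UnitScaleTilt`, crux «MinimiserStabilityRegPr» (stmt-QuantumFields-19200), route-R E′ (A′)-comb, open flat lemma «COMB-FLAT COERCIVITY» (★★OWNER RULINGS g29-№17 (2)∕№18),
# sub-lemma (I3′) «δQ-SLICE» — a NAMED INPUT OF w4-19200 g8's filling certificate F-c: **THE COMB-MINUS-TUBE DEFECT VANISHES ON THE CONSTANT ONE-FORMS**
# `(QTwS 1 − QTw 1)(Σ_μ g_μ dx_μ) = 0` at the flat member — the zero pairing with the three harmonic one-forms of T³ (times `M₂(ℂ)`) that, together with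
# gradient-blindness, lets the defect functional factor through `curl` (the hypothesis `hS` of ✓`Prop7SliceRowOfFilling.sliceBound_conj_of_filling`)

Cell `ym3-torus` (HUMAN RULING D-0037, YM ladder rung R3 — YM₃ on T³ is a rung, NOT d = 4, NOT infinite volume, NOT a mass gap, NOT Clay; YM gap NOT proved), width seat
`ym3-torus-px21` (gen 6; FILL-TO-CAP «width 21»); w4-19200 g8 WORD 2026-08-29 05:11:45Z «`(QTwS 1 − QTw 1) X₀ = 0` for constant `X₀` as a NAMED two-liner: YES PLEASE (GO, your pen,
F-c cites it)».  THEOREMS ONLY (0 `def`, 0 `sorry`); `--supports stmt-QuantumFields-19200 --as helper`; count-neutral.  Nothing here is a claim about the stub, the crux or any summit statement.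

THE PRINT.  [Balaban1984PropagatorsI] (1.11)∕(1.18) p. 19–20 (the tube averages `Q`, `Q_k` — means of the field over straight contours; a constant field is reproduced); [Balaban1985Averaging]
(62) p. 28 (the comb functional), (110)–(112) p. 34, (125)–(127) pp. 36–37, (160) p. 42 (the frames and their linear parts — all of them signed sums of the field along lattice words, hence
translation-invariant functionals of a translation-invariant field); [Balaban1985BackgroundPropagators] (3.14) p. 393.  Print never displays this (it is immediate); F-c needs it NAMED.

WHAT IS PROVED (ns `…Theorems.Prop7QTwFlatConstantForms`).  A bond field is DIRECTION-CONSTANT («constant one-form») if `Y b = g b.dir` (`Σ_μ g_μ dx_μ`, `g_μ ∈ M₂(ℂ)`; the literally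
constant field `fun _ ↦ Z` is the case `g = fun _ ↦ Z`).
* §1 (lit letters on `ℤᵈ`, any `𝔸`; a field `B` with `B x κ = B x′ κ`): `asum_eq_of_siteIndep`, `linQ_eq_of_siteIndep`, `linQIter_siteIndep`, `Fhat_eq_of_siteIndep` — every letter of
  ✓p695582's frame response is SITE-INDEPENDENT on such a field, hence ★ `frameResponse_eq_of_siteIndep` (`r₁` takes the same value at every anchor).
* §2 (torus letters, any `P : Params`): `walkSum_walk_eq_of_dirConst` (the signed sum along `walk x w` of a direction-constant field depends on the word `w` only), ★ `combMean_eq_of_dirConst`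
  (`λ̄_Y(y)` is `y`-independent), `segSum_dirConst`, ★ `bondAvg_dirConst` (`Q` reproduces constant one-forms: `bondAvg (g ∘ dir) = g ∘ dir`), `bondAvgIter_dirConst`,
  ★ `combFamily_eq_of_dirConst` (every comb-functional family `Λ` (`Λ₀ = 0`, `Λ_{i+1}(Y)(y) = Lⁱ·λ̄(Q_iY)(y) + Λ_i(Y)(emb y)`) is `y`-independent on constant one-forms).
* §3 AT THE T³ MEMBER: ★★★ `QTwS_one_sub_QTw_one_dirConst (g c) : QTwS F n K h 1 (fun b ↦ g b.dir) c − QTw F n K h 1 (fun b ↦ g b.dir) c = 0` (✓`Prop7QTwFlatExplicit.QTwS_one_sub_QTw_one_apply`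
  at the canonical families ✓`ChartHInv.exists_linFamily`∕`exists_combFamily`, both coarse gradients vanishing by §1∕§2), ★★ `QTwS_one_sub_QTw_one_const (Z c)` (the literally constant field),
  and the values ★ `QTwS_one_dirConst`∕`QTw_one_dirConst` (`= (L:ℂ)^{K−n} • g c.dir` — both averagings of record reproduce constant one-forms).
HONEST SCOPE.  Bookkeeping identities at the flat member; nothing of (I3′)∕F-c's filling∕COMB-FLAT COERCIVITY∕A6ᶜ∕N06∕EX∕the crux; nothing continuum ∕ OS ∕ mass-gap ∕ Clay.

References: T. Bałaban, CMP **95** (1984) 17–40 [Balaban1984PropagatorsI] ((1.8)–(1.18) pp.19–20); CMP **98** (1985) 17–51 [Balaban1985Averaging] ((62) p.28, (110)–(112) p.34, (125)–(127) pp.36–37,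
(160) p.42); CMP **99** (1985) 389–434 [Balaban1985BackgroundPropagators] ((3.14) p.393).
-/

set_option autoImplicit false

noncomputable section

open scoped Matrix.Norms.L2Operator BigOperators

namespace Summit.QuantumFields.YangMills.Theorems.Prop7QTwFlatConstantForms

open Literature.MathematicalPhysics.QuantumFieldTheory.Balaban1983to89
open Literature.MathematicalPhysics.QuantumFieldTheory.Balaban1983to89.T3ContinuumYM3Torus
open T3LevelShift (bondShift)
open T3PrintedRegularOrbits (sites_eq)
open B7Prop1Explicit renaming Site → LSite
open B7Prop1Explicit (asum stepA boxVec treeWord seg)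
open B7Prop3Flat (Fhat linQ)
open B7Prop4Flat (linQIter)
open B10Eq27TorusAxialLog (transl)
open T4Continuum BlockAveraging LatticeFieldCalculus
open BlockAveragingEMLLinearised (linAvg combMean walkSum walkSum_cons combMean_def)
open Summit.QuantumFields.YangMills.Theorems.Prop7SPrint (basePt)
open Summit.QuantumFields.YangMills.Theorems.Prop7SymAvgTw (coordT3 QTw)
open Summit.QuantumFields.YangMills.Theorems.Prop7SymAvgTwSym (QTwS QTwS_one_apply)
open Summit.QuantumFields.YangMills.Theorems.ChartHInv (exists_linFamily exists_combFamily)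
open Summit.QuantumFields.YangMills.Theorems.Prop7QTwFlatExplicit (QTwS_one_sub_QTw_one_apply QTw_one_eq_tube_sub_coarseGrad)

/-! ## §1 `ℤᵈ` letters: the frame response is site-independent on a site-independent field -/

section Lit

variable {d : ℕ} {𝔸 : Type*} [NormedRing 𝔸] [NormedAlgebra ℂ 𝔸]

omit [NormedAlgebra ℂ 𝔸] in
/-- The contour sum of a site-independent field depends on the word only. [cite: Balaban1985Averaging, p.24] -/
theorem asum_eq_of_siteIndep {B : LSite d → Fin d → 𝔸} (hB : ∀ x x' κ, B x κ = B x' κ) :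
    ∀ (w : List (B7Prop1Explicit.Letter d)) (x x' : LSite d), asum B x w = asum B x' w
  | [], x, x' => by simp
  | l :: w, x, x' => by
    rw [B7Prop1Explicit.asum_cons, B7Prop1Explicit.asum_cons, asum_eq_of_siteIndep hB w (x + l.vec) (x' + l.vec)]
    congr 1
    obtain ⟨μ, b⟩ := l
    cases b
    · rw [B7Prop1Explicit.stepA_false, B7Prop1Explicit.stepA_false, hB]
    · rw [B7Prop1Explicit.stepA_true, B7Prop1Explicit.stepA_true, hB]

/-- The straight-line block average (125) of a site-independent field is site-independent. [cite: Balaban1985Averaging, (125) p.36] -/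
theorem linQ_eq_of_siteIndep (L : ℕ) {B : LSite d → Fin d → 𝔸} (hB : ∀ x x' κ, B x κ = B x' κ) (q q' : LSite d) (κ : Fin d) :
    linQ L B q κ = linQ L B q' κ := by
  unfold linQ
  exact Finset.sum_congr rfl fun r _ => by rw [asum_eq_of_siteIndep hB]

/-- The iterated linear average (127) of a site-independent field is site-independent at every level. [cite: Balaban1985Averaging, (127) p.37] -/
theorem linQIter_siteIndep (L : ℕ) {B : LSite d → Fin d → 𝔸} (hB : ∀ x x' κ, B x κ = B x' κ) :
    ∀ (j : ℕ) (z z' : LSite d) (κ : Fin d), linQIter L B j z κ = linQIter L B j z' κ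
  | 0, z, z', κ => hB z z' κ
  | j + 1, z, z', κ => by
    rw [B7Prop4Flat.linQIter_succ, B7Prop4Flat.linQIter_succ]
    exact linQ_eq_of_siteIndep L (fun x x' κ' => linQIter_siteIndep L hB j x x' κ') _ _ κ

/-- The frame exponent's linearisation (112) of a site-independent field is anchor-independent. [cite: Balaban1985Averaging, (112) p.34] -/
theorem Fhat_eq_of_siteIndep (L : ℕ) {C : LSite d → Fin d → 𝔸} (hC : ∀ x x' κ, C x κ = C x' κ) (q q' : LSite d) :
    Fhat L C q = Fhat L C q' := by
  unfold Fhat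
  exact Finset.sum_congr rfl fun r _ => by rw [asum_eq_of_siteIndep hC]

/-- ★ **THE FLAT FRAME RESPONSE OF ✓p695582 TAKES THE SAME VALUE AT EVERY ANCHOR on a site-independent field.** [cite: Balaban1985Averaging, (160) p.42, (112) p.34, (127) p.37] -/
theorem frameResponse_eq_of_siteIndep (L : ℕ) {B : LSite d → Fin d → 𝔸} (hB : ∀ x x' κ, B x κ = B x' κ) (k : ℕ) (z z' : LSite d) :
    ∑ j ∈ Finset.range k, Fhat L (linQIter L B j) (((L : ℤ) ^ (k - j)) • z)
      = ∑ j ∈ Finset.range k, Fhat L (linQIter L B j) (((L : ℤ) ^ (k - j)) • z') :=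
  Finset.sum_congr rfl fun j _ => Fhat_eq_of_siteIndep L (fun x x' κ => linQIter_siteIndep L hB j x x' κ) _ _

end Lit

/-! ## §2 Torus letters: comb means and tube averages of a constant one-form -/

section Torus

variable {P : Params} {V : Type*} [AddCommGroup V]

/-- The signed sum of a direction-constant field along the walk spelled by `w` from `x` depends on `w` only. [cite: Balaban1984PropagatorsI, (1.8) p.19] -/
theorem walkSum_walk_eq_of_dirConst {j : ℕ} (g : Fin P.d → V) :
    ∀ (w : List (T4Continuum.Letter P.d)) (x x' : Site P j), walkSum (fun b : PBond P j => g b.dir) (walk x w) = walkSum (fun b : PBond P j => g b.dir) (walk x' w)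
  | [], x, x' => rfl
  | (μ, true) :: w, x, x' => by
    simp only [walk, walkSum_cons]
    rw [walkSum_walk_eq_of_dirConst g w]
  | (μ, false) :: w, x, x' => by
    simp only [walk, walkSum_cons]
    rw [walkSum_walk_eq_of_dirConst g w]

variable {n : Type*}

/-- ★ **THE COMB MEAN (62) OF A CONSTANT ONE-FORM IS `y`-INDEPENDENT** (the stair words from the centre do not depend on the block). [cite: Balaban1985Averaging, (62) p.28] -/
theorem combMean_eq_of_dirConst {j : ℕ} (g : Fin P.d → Matrix n n ℂ) (y y' : Site P (j + 1)) :
    combMean (fun b : PBond P j => g b.dir) y = combMean (fun b : PBond P j => g b.dir) y' := by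
  rw [combMean_def, combMean_def, Finset.sum_congr rfl fun i _ => walkSum_walk_eq_of_dirConst g _ (emb y) (emb y')]

variable [Module ℝ V]

omit [Module ℝ V] in
/-- The straight-segment sum of a direction-constant field: `n` copies of `g μ`. [cite: Balaban1984PropagatorsI, (1.8) p.19] -/
theorem segSum_dirConst {j : ℕ} (g : Fin P.d → V) (x : Site P j) (μ : Fin P.d) (m : ℕ) :
    segSum (fun b : PBond P j => g b.dir) x μ m = m • g μ := by
  unfold segSum
  simp [runBond, Finset.sum_const, Finset.card_range]

/-- ★ **THE TUBE AVERAGE (1.11) REPRODUCES CONSTANT ONE-FORMS**: `bondAvg (g ∘ dir) = g ∘ dir`. [cite: Balaban1984PropagatorsI, (1.11) p.19, (1.15) p.19] -/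
theorem bondAvg_dirConst {j : ℕ} (g : Fin P.d → V) :
    bondAvg (fun b : PBond P j => g b.dir) = fun c : PBond P (j + 1) => g c.dir := by
  funext c
  unfold bondAvg
  simp only [segSum_dirConst]
  rw [Finset.sum_const, Finset.card_univ, Fintype.card_fun, Fintype.card_fin, Fintype.card_fin, smul_smul, ← Nat.cast_smul_eq_nsmul ℝ, smul_smul]
  have hL : ((P.L : ℝ) ^ (P.d + 1)) ≠ 0 := pow_ne_zero _ (Nat.cast_ne_zero.mpr P.L_pos.ne')
  have h1 : ((P.L : ℝ) ^ (P.d + 1))⁻¹ * ((P.L ^ P.d * P.L : ℕ) : ℝ) = 1 := by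
    rw [Nat.cast_mul, Nat.cast_pow, ← pow_succ, inv_mul_cancel₀ hL]
  rw [h1, one_smul]

/-- The iterated tube average (1.18) reproduces constant one-forms at every level. [cite: Balaban1984PropagatorsI, (1.18) p.20] -/
theorem bondAvgIter_dirConst (g : Fin P.d → V) : ∀ k : ℕ, bondAvgIter k (fun b : PBond P 0 => g b.dir) = fun c : PBond P k => g c.dir
  | 0 => rfl
  | k + 1 => by
    show bondAvg (bondAvgIter k (fun b : PBond P 0 => g b.dir)) = _
    rw [bondAvgIter_dirConst g k, bondAvg_dirConst]

/-- ★ **EVERY COMB-FUNCTIONAL FAMILY IS `y`-INDEPENDENT ON A CONSTANT ONE-FORM** (`Λ₀ = 0`; `Λ_{i+1}(Y)(y) = Lⁱ·λ̄(Q_iY)(y) + Λ_i(Y)(emb y)` with `Q_iY` again constant and `λ̄`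
`y`-independent). [cite: Balaban1985Averaging, (62) p.28; Balaban1984PropagatorsI, (1.18) p.20] -/
theorem combFamily_eq_of_dirConst
    (Λ : (i : ℕ) → (PBond P 0 → Matrix n n ℂ) → Site P i → Matrix n n ℂ)
    (hΛ0 : ∀ Y y, Λ 0 Y y = 0)
    (hΛs : ∀ (i : ℕ) (Y : PBond P 0 → Matrix n n ℂ) (y : Site P (i + 1)), Λ (i + 1) Y y = (P.L ^ i : ℕ) • combMean (bondAvgIter i Y) y + Λ i Y (emb y))
    (g : Fin P.d → Matrix n n ℂ) : ∀ (i : ℕ) (y y' : Site P i), Λ i (fun b : PBond P 0 => g b.dir) y = Λ i (fun b : PBond P 0 => g b.dir) y'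
  | 0, y, y' => by rw [hΛ0, hΛ0]
  | i + 1, y, y' => by
    rw [hΛs, hΛs, bondAvgIter_dirConst g i, combMean_eq_of_dirConst g y y', combFamily_eq_of_dirConst Λ hΛ0 hΛs g i (emb y) (emb y')]

end Torus

/-! ## §3 At the T³ member: the defect vanishes on constant one-forms -/

section Member

variable (F : T3Family) {n K : ℕ} (h : n ≤ K)

/-- ★★★ **THE COMB-MINUS-TUBE DEFECT VANISHES ON THE CONSTANT ONE-FORMS** `X₀ = Σ_μ g_μ dx_μ` (`X₀ b = g b.dir`, `g_μ ∈ M₂(ℂ)`): `QTwS 1 X₀ c − QTw 1 X₀ c = 0` at every coarse bond —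
by ✓`QTwS_one_sub_QTw_one_apply` both summands are coarse gradients of site-INDEPENDENT quantities (§1: the frame response `r₁X₀`; §2: the comb functional `Λ_{K−n}X₀`).  With
gradient-blindness (RULING №18) this is the zero pairing with T³'s harmonic one-forms that F-c's filling hypothesis `hS` (✓`Prop7SliceRowOfFilling`) presupposes.
[cite: Balaban1984PropagatorsI, (1.11)–(1.18) pp.19–20; Balaban1985Averaging, (62) p.28, (112) p.34, (127) p.37, (160) p.42; Balaban1985BackgroundPropagators, (3.14) p.393] -/
theorem QTwS_one_sub_QTw_one_dirConst (g : Fin (F.P K).d → Matrix (Fin 2) (Fin 2) ℂ) (c : PBond (F.P n) 0) :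
    QTwS F n K h 1 (fun b : PBond (F.P K) 0 => g b.dir) c - QTw F n K h 1 (fun b : PBond (F.P K) 0 => g b.dir) c = 0 := by
  obtain ⟨Q, hQ0, hQs⟩ := exists_linFamily (P := F.P K) (n := Fin 2)
  obtain ⟨Λ, hΛ0, hΛs⟩ := exists_combFamily (P := F.P K) (n := Fin 2)
  rw [QTwS_one_sub_QTw_one_apply F h Q hQ0 hQs Λ hΛ0 hΛs]
  -- the pulled-back exponent of a constant one-form is site-independent on `ℤ³`
  have hB : ∀ (x x' : LSite (F.P K).d) (κ : Fin (F.P K).d),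
      (fun (z : LSite (F.P K).d) (κ : Fin (F.P K).d) => (fun b : PBond (F.P K) 0 => g b.dir) ⟨transl (basePt F n K) z, κ⟩) x κ
        = (fun (z : LSite (F.P K).d) (κ : Fin (F.P K).d) => (fun b : PBond (F.P K) 0 => g b.dir) ⟨transl (basePt F n K) z, κ⟩) x' κ := fun _ _ _ => rfl
  rw [combFamily_eq_of_dirConst Λ hΛ0 hΛs g (K - n) (bondShift (sites_eq F n K h) c).tgt (bondShift (sites_eq F n K h) c).src,
    frameResponse_eq_of_siteIndep (F.P K).L hB (K - n) (coordT3 F n K h c.src) (coordT3 F n K h c.tgt)]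
  simp

/-- ★★ **THE LITERALLY CONSTANT FIELD**: `QTwS 1 (fun _ ↦ Z) c − QTw 1 (fun _ ↦ Z) c = 0`. [cite: Balaban1984PropagatorsI, (1.15) p.19; Balaban1985BackgroundPropagators, (3.14) p.393] -/
theorem QTwS_one_sub_QTw_one_const (Z : Matrix (Fin 2) (Fin 2) ℂ) (c : PBond (F.P n) 0) :
    QTwS F n K h 1 (fun _ : PBond (F.P K) 0 => Z) c - QTw F n K h 1 (fun _ : PBond (F.P K) 0 => Z) c = 0 :=
  QTwS_one_sub_QTw_one_dirConst F h (fun _ => Z) c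

/-- ★ **THE TUBE AVERAGING OF RECORD ON A CONSTANT ONE-FORM**: `QTwS 1 X₀ c = (L:ℂ)^{K−n} • g c.dir` (✓`QTwS_one_apply` ∘ `bondAvgIter_dirConst`; the coarse bond's direction is preserved by
`bondShift`). [cite: Balaban1984PropagatorsI, (1.18) p.20] -/
theorem QTwS_one_dirConst (g : Fin (F.P K).d → Matrix (Fin 2) (Fin 2) ℂ) (c : PBond (F.P n) 0) :
    QTwS F n K h 1 (fun b : PBond (F.P K) 0 => g b.dir) c = ((((F.P K).L : ℕ) : ℂ) ^ (K - n)) • g c.dir := by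
  rw [QTwS_one_apply, bondAvgIter_dirConst]
  rfl

/-- ★ **THE COMB AVERAGING OF RECORD ON A CONSTANT ONE-FORM**: `QTw 1 X₀ c = (L:ℂ)^{K−n} • g c.dir` as well. [cite: Balaban1985BackgroundPropagators, (3.14) p.393; Balaban1984PropagatorsI, (1.18) p.20] -/
theorem QTw_one_dirConst (g : Fin (F.P K).d → Matrix (Fin 2) (Fin 2) ℂ) (c : PBond (F.P n) 0) :
    QTw F n K h 1 (fun b : PBond (F.P K) 0 => g b.dir) c = ((((F.P K).L : ℕ) : ℂ) ^ (K - n)) • g c.dir := by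
  have h0 := QTwS_one_sub_QTw_one_dirConst F h g c
  rw [sub_eq_zero] at h0
  rw [← h0, QTwS_one_dirConst]

end Member

end Summit.QuantumFields.YangMills.Theorems.Prop7QTwFlatConstantForms

end
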